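import Mathlib
import HarnessLib
import Literature.Analysis.FluidPDE.TaoAveragedStandardTriple
import Literature.Analysis.FluidPDE.TaoAveragedSingleScaleAtOfJointWeight
import Summits.NavierStokesRegularity.NavierStokesRegularity.Theses.TaoLadderRungOne

/-!
# Route TaoLadderRungOne — crux `SingleScaleNoDilAt` (stmt-NavierStokesRegularity-20473) REDUCED to a
# joint-weight rotation identity about STANDARD triples (helper, `--supports`; does not close the item)

HONEST FRAMING: MODEL statements (Tao 2016's single-scale identity (3.9)/(3.13) for his local cascade
class, arXiv:1402.0290 §3.5–3.9); nothing here concerns the true Navier–Stokes equations.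

**What this file records in the kernel.** The crux asks, for every `κ > 0`, for a threshold `ε₁`
below which `C₀` is a DILATION-FREE complex average of `B_{η,ρ,0;ξ}` for every closed base triangle
`ξ` with sides in `[4/5, 3/2]` and input gap `≥ κε₀` and all profiles normalised about `ξ`. By the
Literature groundwork of the cell's p1 g6 seat —
`singleScaleAt_isComplexAverageNoDil_of_stdTriple` (every closed triple is a rotated standard triple
`stdTriple a x y = ((0,a,0),(−x,−a−y,0),(x,y,0))`, and the sentence is covariant under common
rotations) and `singleScaleAt_isComplexAverageNoDil_of_jointWeightAt` (§3.5 symbol extraction +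
§3.6 plane-wave synthesis about `ξ`) — the crux FOLLOWS from the hypothesis `JointWeightStd` below:
for standard triples in the window with the gap, joint-weight data `(d, μ₀, E, F)` reproducing
`∏ⱼ ∫ Xⱼ · \overline{ψ̂ⱼ}` — the exact analogue, at `stdTriple a x y` instead of Tao's
`xi0 = stdTriple 1 1 0`, of the tree's named fact `rotationAverage_jointWeight` (§3.6–3.9, proved at
`xi0`: `rotationAverage_jointWeight_holds`). The hypothesis is NOT proved here (it is the remaining
content of the crux: `TaoAveragedJointWeightData/Proofs` with `xi0 ↦ stdTriple a x y`).
-/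

-- the sub-problem namespace `Summit.NavierStokesRegularity.NavierStokesRegularity` repeats the summit name by design (D-0017)
set_option linter.dupNamespace false

namespace Summit.NavierStokesRegularity.NavierStokesRegularity.Theorems

open MeasureTheory FourierTransform
open Literature.Analysis.FluidPDE.Tao2016
open Summit.NavierStokesRegularity.NavierStokesRegularity.Theses.TaoLadderRungOne

/-- **`SingleScaleNoDilAt` from the joint-weight identity about standard triples.** If for every
`κ > 0` there is `ε₁ > 0` such that for `0 < ε₀ ≤ ε₁`, every standard triple `stdTriple a x y`
(`x ≥ 0`) with side lengths in `[4/5, 3/2]` and input gap `≥ κε₀`, and every profile triple `ψ`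
normalised about it, there are joint-weight data — `d`, a finite measure `μ₀` on `(Fin d → ℝ³)`, a
measurable rotation family `E`, a smooth compactly supported `F` — with
`jointWeightAverageW μ₀ E (φ η_std) F X₁ X₂ X₃ = ∏ⱼ ∫ Xⱼ · \overline{ψ̂ⱼ}` for all div-free
`Xⱼ ∈ L¹ ∩ L²`, then the crux `SingleScaleNoDilAt` holds. [cite: Tao2016AveragedNS, §3.2 (3.7), §3.5–3.6 (3.13)–(3.16), Remark 3.5 p. 20] -/
theorem taoLadderRungOne_singleScaleNoDilAt_of_jointWeightStd
    (H : ∀ κ : ℝ, 0 < κ → ∃ ε₁ : ℝ, 0 < ε₁ ∧ ∀ ε₀ : ℝ, 0 < ε₀ → ε₀ ≤ ε₁ →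
      ∀ a x y : ℝ, 0 ≤ x →
        (∀ j, 4 / 5 ≤ ‖stdTriple a x y j‖ ∧ ‖stdTriple a x y j‖ ≤ 3 / 2) →
        κ * ε₀ ≤ |‖stdTriple a x y 0‖ - ‖stdTriple a x y 1‖| →
        ∀ ψ : Fin 3 → SchwartzMap (EuclideanSpace ℝ (Fin 3)) (EuclideanSpace ℂ (Fin 3)),
          NormalisedProfilesAt (stdTriple a x y) ε₀ ψ →
          ∃ (d : ℕ) (μ₀ : Measure (Fin d → EuclideanSpace ℝ (Fin 3))), IsFiniteMeasure μ₀ ∧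
            ∃ E : Fin 3 → (Fin d → EuclideanSpace ℝ (Fin 3)) →
                (EuclideanSpace ℝ (Fin 3) ≃ₗᵢ[ℝ] EuclideanSpace ℝ (Fin 3)),
              IsRotationFamily E ∧
              ∃ F : (Fin d → EuclideanSpace ℝ (Fin 3)) ×
                  (EuclideanSpace ℝ (Fin 3) × EuclideanSpace ℝ (Fin 3)) → ℂ,
                ContDiff ℝ ((⊤ : ℕ∞) : WithTop ℕ∞) F ∧ HasCompactSupport F ∧
                ∀ X₁ X₂ X₃ : EuclideanSpace ℝ (Fin 3) → EuclideanSpace ℂ (Fin 3),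
                  FreqIntegrable X₁ → FreqIntegrable X₂ → FreqIntegrable X₃ →
                  FreqDivFree X₁ → FreqDivFree X₂ → FreqDivFree X₃ →
                    jointWeightAverageW μ₀ E (singleScaleWeightAtC (stdTriple a x y) ε₀) F X₁ X₂ X₃ =
                      (∫ ζ, cdot (X₁ ζ) (conj3 (𝓕 (⇑(ψ 0)) ζ))) *
                        (∫ ζ, cdot (X₂ ζ) (conj3 (𝓕 (⇑(ψ 1)) ζ))) *
                          ∫ ζ, cdot (X₃ ζ) (conj3 (𝓕 (⇑(ψ 2)) ζ))) :
    SingleScaleNoDilAt := by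
  intro κ hκ
  obtain ⟨ε₁, hε₁, H⟩ := H κ hκ
  refine ⟨ε₁, hε₁, fun ε₀ hε₀ hle ξ hsum hwin hgap ψ hψ => ?_⟩
  have h0 : ξ 0 ≠ 0 := by
    intro h
    have := (hwin 0).1
    rw [h, norm_zero] at this
    linarith
  refine singleScaleAt_isComplexAverageNoDil_of_stdTriple hsum h0 (fun S x y hx hS φ hφ => ?_) ψ hψ
  -- the standard representative inherits the window and the gap (`S` is an isometry)
  have hnorm : ∀ j, ‖stdTriple ‖ξ 0‖ x y j‖ = ‖ξ j‖ := fun j => by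
    rw [hS j, LinearIsometryEquiv.norm_map]
  have hwin' : ∀ j, 4 / 5 ≤ ‖stdTriple ‖ξ 0‖ x y j‖ ∧ ‖stdTriple ‖ξ 0‖ x y j‖ ≤ 3 / 2 := fun j => by
    rw [hnorm j]; exact hwin j
  have hgap' : κ * ε₀ ≤ |‖stdTriple ‖ξ 0‖ x y 0‖ - ‖stdTriple ‖ξ 0‖ x y 1‖| := by
    rw [hnorm 0, hnorm 1]; exact hgap
  obtain ⟨d, μ₀, hμ₀, E, hE, F, hF, hFc, hid⟩ := H ε₀ hε₀ hle ‖ξ 0‖ x y hx hwin' hgap' φ hφ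
  haveI := hμ₀
  exact singleScaleAt_isComplexAverageNoDil_of_jointWeightAt (stdTriple ‖ξ 0‖ x y) ε₀ φ μ₀ hE hF hFc hid

end Summit.NavierStokesRegularity.NavierStokesRegularity.Theorems
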